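import Summits.QuantumFields.YangMills.Theorems.PencilRigidityCurvatureKernelBoundTensorRegularityPlaneWave

/-!
# Three-slot regularity, Part 3: scaled cut-offs with explicit Schwartz bounds

Support file for stub `stub_threeSlotRegularity` (C) of reshape 4 of
`Cruxes/TemperedCurvatureMoments/Lines/Sketch.lean` (crux stmt-QuantumFields-17721, line `Sketch`).
The quantitative input that the two-slot `CurvatureKernel.TensorRegularity` did not need: a family of
smooth cut-offs `χ_{c,ρ}` (`= 1` on `B(c, ρ/2)`, supported in `B̄(c, 3ρ/4) ⊆ B(c, ρ)`) obtained from ONE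
reference bump `χ_ref` by the affine change of variables `y ↦ ρ⁻¹(y − c)`, whose Schwartz norms — and
those of their line derivatives `(∂_t)^[m] χ_{c,ρ}`, `‖t‖ ≤ 2` — are bounded by
`(2 (1 + ‖c‖) ρ⁻¹)^{M+m} C(M+m)` with ONE monotone sequence of constants `C(M) = |χ_ref|_M`
(`exists_scaled_cutoffs`: chain rule with a homothety, `‖Dⁿ(f ∘ (ρ⁻¹(· − c)))‖ ≤ ρ^{-n} ‖Dⁿf‖`, supports
in `B̄(c, 3ρ/4)` so that `‖y‖ ≤ 1 + ‖c‖` there, and `|∂_t f|_{k,l} ≤ ‖t‖ |f|_{k,l+1}`).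
[folklore]
-/

noncomputable section

namespace Summit.QuantumFields.YangMills.Theorems.TemperedCurvatureMoments.Sketch

namespace ThreeSlotRegularity

open scoped BigOperators SchwartzMap LineDeriv ContDiff
open MeasureTheory Filter Topology Set Metric
open Literature.MathematicalPhysics.QuantumLattice

section LineDerivNorm

variable {E : Type*} [NormedAddCommGroup E] [NormedSpace ℝ E]

/-- `|∂_t ψ|_M ≤ ‖t‖ |ψ|_{M+1}` for the tree's Schwartz norms (one line derivative costs one order).
[folklore] -/
theorem schwartzNorm_lineDerivOp_le_norm_mul (t : E) (ψ : 𝓢(E, ℂ)) (M : ℕ) :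
    schwartzNorm M (∂_{t} ψ : 𝓢(E, ℂ)) ≤ ‖t‖ * schwartzNorm (M + 1) ψ := by
  -- one line derivative on the seminorms
  have hstep : ∀ k l : ℕ, SchwartzMap.seminorm ℂ k l (∂_{t} ψ : 𝓢(E, ℂ)) ≤
      ‖t‖ * SchwartzMap.seminorm ℂ k (l + 1) ψ := by
    intro k l
    refine SchwartzMap.seminorm_le_bound ℂ k l _ (by positivity) fun x => ?_
    have hcoe : ((∂_{t} ψ : 𝓢(E, ℂ)) : E → ℂ) = fun y => fderiv ℝ (ψ : E → ℂ) y t :=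
      funext fun y => SchwartzMap.lineDerivOp_apply_eq_fderiv t ψ y
    rw [hcoe]
    have hf : ContDiff ℝ l (fderiv ℝ (ψ : E → ℂ)) := (ψ.smooth (l + 1)).fderiv_right (by norm_cast)
    have h1 : ‖iteratedFDeriv ℝ l (fun y => fderiv ℝ (ψ : E → ℂ) y t) x‖ ≤
        ‖t‖ * ‖iteratedFDeriv ℝ l (fderiv ℝ (ψ : E → ℂ)) x‖ :=
      norm_iteratedFDeriv_clm_apply_const hf.contDiffAt le_rfl
    rw [norm_iteratedFDeriv_fderiv] at h1
    calc ‖x‖ ^ k * ‖iteratedFDeriv ℝ l (fun y => fderiv ℝ (ψ : E → ℂ) y t) x‖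
        ≤ ‖x‖ ^ k * (‖t‖ * ‖iteratedFDeriv ℝ (l + 1) (ψ : E → ℂ) x‖) := by gcongr
      _ = ‖t‖ * (‖x‖ ^ k * ‖iteratedFDeriv ℝ (l + 1) (ψ : E → ℂ) x‖) := by ring
      _ ≤ ‖t‖ * SchwartzMap.seminorm ℂ k (l + 1) ψ := by
          gcongr; exact SchwartzMap.le_seminorm ℂ k (l + 1) ψ x
  unfold schwartzNorm
  refine Seminorm.finset_sup_apply_le (mul_nonneg (norm_nonneg _) (apply_nonneg _ _)) fun i hi => ?_
  obtain ⟨hk, hl⟩ := Prod.mk_le_mk.1 (Finset.mem_Iic.1 hi)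
  rw [SchwartzMap.schwartzSeminormFamily_apply]
  exact (hstep i.1 i.2).trans
    (mul_le_mul_of_nonneg_left (seminorm_le_schwartzNorm (by omega) (by omega) ψ) (norm_nonneg _))

end LineDerivNorm

section Cutoff

variable {E : Type*} [NormedAddCommGroup E] [InnerProductSpace ℝ E] [FiniteDimensional ℝ E]

variable (E) in
/-- **Scaled cut-offs with explicit Schwartz bounds.** There is a monotone sequence of constants
`C : ℕ → ℝ` such that for every centre `c` and scale `ρ ∈ (0, 1]` there is a Schwartz cut-off `χ` with
`supp χ ⊆ B(c, ρ)`, `χ = 1` on `B(c, ρ/2)`, and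
`|(∂_t)^[m] χ|_M ≤ (2 (1 + ‖c‖) ρ⁻¹)^{M+m} C(M+m)` for all `‖t‖ ≤ 2` and all `m, M`
(`χ(y) = χ_ref(ρ⁻¹(y − c))` for one reference bump `χ_ref`, `C(M) = |χ_ref|_M`). [folklore] -/
theorem exists_scaled_cutoffs :
    ∃ C : ℕ → ℝ, (∀ M, 0 ≤ C M) ∧ Monotone C ∧
      ∀ (c : E) (ρ : ℝ), 0 < ρ → ρ ≤ 1 → ∃ χ : 𝓢(E, ℂ),
        tsupport (χ : E → ℂ) ⊆ ball c ρ ∧ (∀ y ∈ ball c (ρ / 2), χ y = 1) ∧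
        ∀ t : E, ‖t‖ ≤ 2 → ∀ m M : ℕ,
          schwartzNorm M (((∂_{t} : 𝓢(E, ℂ) → 𝓢(E, ℂ))^[m]) χ) ≤ (2 * (1 + ‖c‖) * ρ⁻¹) ^ (M + m) * C (M + m) := by
  -- the reference bump `χ_ref`
  let φ : ContDiffBump (0 : E) := ⟨1 / 2, 3 / 4, by norm_num, by norm_num⟩
  set g₀ : E → ℂ := fun z => ((φ z : ℝ) : ℂ) with hg₀
  have hg₀d : ContDiff ℝ ((⊤ : ℕ∞) : WithTop ℕ∞) g₀ := Complex.ofRealCLM.contDiff.comp φ.contDiff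
  have hg₀zero : ∀ z : E, 3 / 4 ≤ ‖z‖ → g₀ z = 0 := by
    intro z hz
    have h : φ z = 0 := φ.zero_of_le_dist (by rw [dist_zero_right]; exact hz)
    simp [hg₀, h]
  have hg₀one : ∀ z : E, ‖z‖ ≤ 1 / 2 → g₀ z = 1 := by
    intro z hz
    have h : φ z = 1 := φ.one_of_mem_closedBall (by rw [mem_closedBall, dist_zero_right]; exact hz)
    simp [hg₀, h]
  have hg₀supp : tsupport g₀ ⊆ closedBall (0 : E) (3 / 4) := by
    refine closure_minimal (fun z hz => ?_) isClosed_closedBall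
    rw [mem_closedBall, dist_zero_right]
    by_contra h
    exact hz (hg₀zero z (not_le.1 h).le)
  have hg₀cs : HasCompactSupport g₀ :=
    HasCompactSupport.of_support_subset_isCompact (isCompact_closedBall (0 : E) (3 / 4))
      ((subset_tsupport _).trans hg₀supp)
  set χ₀ : 𝓢(E, ℂ) := hg₀cs.toSchwartzMap hg₀d with hχ₀
  have hχ₀coe : ((χ₀ : 𝓢(E, ℂ)) : E → ℂ) = g₀ := rfl
  have hsn : ∀ n : ℕ, 0 ≤ SchwartzMap.seminorm ℂ 0 n χ₀ := fun n => apply_nonneg _ _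
  have hDg₀ : ∀ (n : ℕ) (z : E), ‖iteratedFDeriv ℝ n g₀ z‖ ≤ SchwartzMap.seminorm ℂ 0 n χ₀ := by
    intro n z
    have h := SchwartzMap.le_seminorm ℂ 0 n χ₀ z
    rw [pow_zero, one_mul, hχ₀coe] at h
    exact h
  refine ⟨fun M => schwartzNorm M χ₀, fun M => schwartzNorm_nonneg _ _, fun M M' h => schwartzNorm_mono h _, ?_⟩
  intro c ρ hρ hρ1
  have hρi0 : 0 < ρ⁻¹ := inv_pos.2 hρ
  have hρi : 1 ≤ ρ⁻¹ := one_le_inv_iff₀.2 ⟨hρ, hρ1⟩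
  have hc1 : 1 ≤ 1 + ‖c‖ := by linarith [norm_nonneg c]
  -- the scaled cut-off `χ(y) = χ_ref(ρ⁻¹(y − c))`
  set g : E → ℂ := fun y => g₀ (ρ⁻¹ • (y - c)) with hg
  have hgd : ContDiff ℝ ((⊤ : ℕ∞) : WithTop ℕ∞) g :=
    hg₀d.comp ((contDiff_id.sub contDiff_const).const_smul ρ⁻¹)
  have hgzero : ∀ y : E, 3 / 4 * ρ ≤ dist y c → g y = 0 := by
    intro y hy
    refine hg₀zero _ ?_
    rw [norm_smul, Real.norm_eq_abs, abs_of_pos hρi0, ← dist_eq_norm, le_inv_mul_iff₀ hρ]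
    linarith
  have hgsupp : tsupport g ⊆ closedBall c (3 / 4 * ρ) := by
    refine closure_minimal (fun z hz => ?_) isClosed_closedBall
    rw [mem_closedBall]
    by_contra h
    exact hz (hgzero z (not_le.1 h).le)
  have hgcs : HasCompactSupport g :=
    HasCompactSupport.of_support_subset_isCompact (isCompact_closedBall c (3 / 4 * ρ))
      ((subset_tsupport _).trans hgsupp)
  set χ : 𝓢(E, ℂ) := hgcs.toSchwartzMap hgd with hχ
  have hχcoe : ((χ : 𝓢(E, ℂ)) : E → ℂ) = g := rfl
  refine ⟨χ, ?_, ?_, ?_⟩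
  · -- support
    rw [hχcoe]
    exact hgsupp.trans (closedBall_subset_ball (by linarith))
  · -- `χ = 1` on `B(c, ρ/2)`
    intro y hy
    change g y = 1
    refine hg₀one _ ?_
    rw [norm_smul, Real.norm_eq_abs, abs_of_pos hρi0, ← dist_eq_norm, inv_mul_le_iff₀ hρ]
    have := mem_ball.1 hy
    linarith
  · intro t ht m M
    -- chain rule with the homothety: `‖Dⁿ χ(y)‖ ≤ ρ^{-n} |χ_ref|_{0,n}`
    have hD : ∀ (n : ℕ) (y : E), ‖iteratedFDeriv ℝ n g y‖ ≤ ρ⁻¹ ^ n * SchwartzMap.seminorm ℂ 0 n χ₀ := by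
      intro n y
      set L : E →L[ℝ] E := ρ⁻¹ • ContinuousLinearMap.id ℝ E with hL
      have hLw : ∀ v : E, L v = ρ⁻¹ • v := fun v => by simp [hL]
      have h1 : g = fun w => (g₀ ∘ L) (w - c) := by
        funext w; simp only [hg, Function.comp_apply, hLw]
      rw [h1, iteratedFDeriv_comp_sub, ContinuousLinearMap.iteratedFDeriv_comp_right _ hg₀d _
        (by exact_mod_cast le_top)]
      refine (ContinuousMultilinearMap.norm_compContinuousLinearMap_le _ _).trans ?_
      rw [Finset.prod_const, Finset.card_univ, Fintype.card_fin, mul_comm]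
      have hLn : ‖L‖ ≤ ρ⁻¹ := by
        refine ContinuousLinearMap.opNorm_le_bound _ hρi0.le fun v => ?_
        rw [hLw, norm_smul, Real.norm_eq_abs, abs_of_pos hρi0]
      exact mul_le_mul (pow_le_pow_left₀ (norm_nonneg _) hLn n) (hDg₀ n _) (norm_nonneg _)
        (pow_nonneg hρi0.le n)
    -- seminorms of `χ`: on the support `‖y‖ ≤ 1 + ‖c‖`
    have hsemi : ∀ k n : ℕ, SchwartzMap.seminorm ℂ k n χ ≤
        (1 + ‖c‖) ^ k * (ρ⁻¹ ^ n * SchwartzMap.seminorm ℂ 0 n χ₀) := by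
      intro k n
      have hK0 : 0 ≤ (1 + ‖c‖) ^ k * (ρ⁻¹ ^ n * SchwartzMap.seminorm ℂ 0 n χ₀) :=
        mul_nonneg (by positivity) (mul_nonneg (by positivity) (hsn n))
      refine SchwartzMap.seminorm_le_bound ℂ k n _ hK0 fun y => ?_
      rw [hχcoe]
      by_cases hy : y ∈ tsupport g
      · have hyc : dist y c ≤ 3 / 4 * ρ := mem_closedBall.1 (hgsupp hy)
        have hny : ‖y‖ ≤ 1 + ‖c‖ := by
          have h1 : ‖y‖ ≤ ‖y - c‖ + ‖c‖ := norm_le_norm_sub_add y c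
          rw [← dist_eq_norm] at h1
          linarith
        exact mul_le_mul (pow_le_pow_left₀ (norm_nonneg _) hny k) (hD n y) (norm_nonneg _) (by positivity)
      · have h0 : iteratedFDeriv ℝ n g y = 0 :=
          image_eq_zero_of_notMem_tsupport fun h => hy (tsupport_iteratedFDeriv_subset n h)
        rw [h0, norm_zero, mul_zero]
        exact hK0
    -- Schwartz norms of `χ`
    have hnorm : ∀ M' : ℕ, schwartzNorm M' χ ≤ (1 + ‖c‖) ^ M' * ρ⁻¹ ^ M' * schwartzNorm M' χ₀ := by
      intro M'
      have h0 := schwartzNorm_nonneg M' χ₀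
      unfold schwartzNorm at h0 ⊢
      refine Seminorm.finset_sup_apply_le (mul_nonneg (by positivity) h0) fun i hi => ?_
      obtain ⟨hk, hl⟩ := Prod.mk_le_mk.1 (Finset.mem_Iic.1 hi)
      rw [SchwartzMap.schwartzSeminormFamily_apply]
      refine (hsemi i.1 i.2).trans ?_
      have h3 : SchwartzMap.seminorm ℂ 0 i.2 χ₀ ≤ schwartzNorm M' χ₀ := seminorm_le_schwartzNorm (Nat.zero_le _) hl _
      unfold schwartzNorm at h3
      calc (1 + ‖c‖) ^ i.1 * (ρ⁻¹ ^ i.2 * SchwartzMap.seminorm ℂ 0 i.2 χ₀)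
          ≤ (1 + ‖c‖) ^ M' * (ρ⁻¹ ^ M' * ((Finset.Iic (M', M')).sup (schwartzSeminormFamily ℂ E ℂ)) χ₀) :=
            mul_le_mul (pow_le_pow_right₀ hc1 hk) (mul_le_mul (pow_le_pow_right₀ hρi hl) h3
              (hsn _) (by positivity)) (mul_nonneg (by positivity) (hsn _)) (by positivity)
        _ = _ := by ring
    -- iterated line derivatives: `|(∂_t)^[n] χ|_{M'} ≤ ‖t‖ⁿ |χ|_{M'+n}`
    have hiter : ∀ n M' : ℕ, schwartzNorm M' (((∂_{t} : 𝓢(E, ℂ) → 𝓢(E, ℂ))^[n]) χ) ≤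
        ‖t‖ ^ n * schwartzNorm (M' + n) χ := by
      intro n
      induction n with
      | zero => intro M'; simp
      | succ n ih =>
        intro M'
        rw [Function.iterate_succ_apply']
        calc schwartzNorm M' (∂_{t} (((∂_{t} : 𝓢(E, ℂ) → 𝓢(E, ℂ))^[n]) χ) : 𝓢(E, ℂ))
            ≤ ‖t‖ * schwartzNorm (M' + 1) (((∂_{t} : 𝓢(E, ℂ) → 𝓢(E, ℂ))^[n]) χ) :=
              schwartzNorm_lineDerivOp_le_norm_mul _ _ _
          _ ≤ ‖t‖ * (‖t‖ ^ n * schwartzNorm (M' + 1 + n) χ) :=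
              mul_le_mul_of_nonneg_left (ih (M' + 1)) (norm_nonneg _)
          _ = ‖t‖ ^ (n + 1) * schwartzNorm (M' + (n + 1)) χ := by
              rw [pow_succ, show M' + 1 + n = M' + (n + 1) by omega]; ring
    -- combine
    have hC0 := schwartzNorm_nonneg (M + m) χ₀
    have h2 : ‖t‖ ^ m ≤ 2 ^ (M + m) :=
      (pow_le_pow_left₀ (norm_nonneg _) ht m).trans (pow_le_pow_right₀ (by norm_num) (by omega))
    calc schwartzNorm M (((∂_{t} : 𝓢(E, ℂ) → 𝓢(E, ℂ))^[m]) χ)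
        ≤ ‖t‖ ^ m * schwartzNorm (M + m) χ := hiter m M
      _ ≤ ‖t‖ ^ m * ((1 + ‖c‖) ^ (M + m) * ρ⁻¹ ^ (M + m) * schwartzNorm (M + m) χ₀) :=
          mul_le_mul_of_nonneg_left (hnorm (M + m)) (pow_nonneg (norm_nonneg _) _)
      _ ≤ 2 ^ (M + m) * ((1 + ‖c‖) ^ (M + m) * ρ⁻¹ ^ (M + m) * schwartzNorm (M + m) χ₀) :=
          mul_le_mul_of_nonneg_right h2 (mul_nonneg (by positivity) hC0)
      _ = (2 * (1 + ‖c‖) * ρ⁻¹) ^ (M + m) * schwartzNorm (M + m) χ₀ := by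
          rw [mul_pow, mul_pow]; ring

/-- **Uniform form up to a derivative order `N₁`.** With the constants of `exists_scaled_cutoffs`:
for every `c`, `ρ ∈ (0,1]` a cut-off `χ` (`supp χ ⊆ B(c,ρ)`, `χ = 1` on `B(c,ρ/2)`) with
`|(∂_t)^[m] χ|_M ≤ (2 (1 + ‖c‖) ρ⁻¹)^{M+N₁} C(M+N₁)` for all `‖t‖ ≤ 2`, `m ≤ N₁`. [folklore] -/
theorem exists_scaled_cutoffs_le (M N₁ : ℕ) :
    ∃ C₀ : ℝ, 0 ≤ C₀ ∧
      ∀ (c : E) (ρ : ℝ), 0 < ρ → ρ ≤ 1 → ∃ χ : 𝓢(E, ℂ),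
        tsupport (χ : E → ℂ) ⊆ ball c ρ ∧ (∀ y ∈ ball c (ρ / 2), χ y = 1) ∧
        ∀ t : E, ‖t‖ ≤ 2 → ∀ m : ℕ, m ≤ N₁ →
          schwartzNorm M (((∂_{t} : 𝓢(E, ℂ) → 𝓢(E, ℂ))^[m]) χ) ≤ ((1 + ‖c‖) * ρ⁻¹) ^ (M + N₁) * C₀ := by
  obtain ⟨C, hC0, hCmono, hC⟩ := exists_scaled_cutoffs E
  refine ⟨2 ^ (M + N₁) * C (M + N₁), mul_nonneg (by positivity) (hC0 _), fun c ρ hρ hρ1 => ?_⟩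
  obtain ⟨χ, hsupp, hone, hbd⟩ := hC c ρ hρ hρ1
  refine ⟨χ, hsupp, hone, fun t ht m hm => (hbd t ht m M).trans ?_⟩
  have hρi : 1 ≤ ρ⁻¹ := one_le_inv_iff₀.2 ⟨hρ, hρ1⟩
  have hc1 : 1 ≤ 1 + ‖c‖ := by linarith [norm_nonneg c]
  have hbase : 1 ≤ 2 * (1 + ‖c‖) * ρ⁻¹ := by nlinarith
  calc (2 * (1 + ‖c‖) * ρ⁻¹) ^ (M + m) * C (M + m)
      ≤ (2 * (1 + ‖c‖) * ρ⁻¹) ^ (M + N₁) * C (M + N₁) :=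
        mul_le_mul (pow_le_pow_right₀ hbase (by omega)) (hCmono (by omega)) (hC0 _) (by positivity)
    _ = ((1 + ‖c‖) * ρ⁻¹) ^ (M + N₁) * (2 ^ (M + N₁) * C (M + N₁)) := by
        rw [mul_pow, mul_pow, mul_pow]; ring

end Cutoff

end ThreeSlotRegularity

end Summit.QuantumFields.YangMills.Theorems.TemperedCurvatureMoments.Sketch

end
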